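import Literature.NumberTheory.LFunctions.NymanBeurlingRateLargeOrdinates
import HarnessLib

/-!
# Balazard–de Roton 2010, Proposition 14 and Proposition 3: `I_{N,ε} ≪ N^{-ε/2}` from the
# pointwise approximation of `1/ζ` (Prop. 10) and the critical-line bound (14.14.1)

Topic `Literature/NumberTheory/LFunctions`; a brick of the proof of Balazard–de Roton 2010,
Théorème 1 (`Literature.NumberTheory.LFunctions.BalazardDeRoton2010_thm1`, `NymanBeurlingRate.lean`).
M. Balazard, A. de Roton, *Sur un critère de Báez-Duarte pour l'hypothèse de Riemann*, Int. J.
Number Theory 6 (2010) 883–903 = arXiv:0812.1689, §2 (Prop. 3), §6 (Prop. 10), §7 (Prop. 14):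

> **Proposition 14 (HR).** For `N` large and `ε ≥ 25(log log N)^{5/2+6δ}(log N)^{-1/2}`,
> `∫_{|τ|≤N^{3/4}} |ζ(s)|²|ζ(s+ε)^{-1} − M_N(s+ε)|² dτ/|s|² ≪ N^{-ε/2}`,

printed proof: Prop. 10 (`|ζ(s+ε)^{-1} − M_N(s+ε)| ≪ N^{-ε/4}(1+|τ|)^{1/2−β(τ)}` for
`|τ| ≤ N^{3/4}`, `β(τ) = log log log(16+|τ|)/(2 log log(16+|τ|))`) and
`|ζ(s)|² ≪ exp(O(log(3+|τ|)/log log(3+|τ|))) ≪ (1+|τ|)^{β(τ)}` (Titchmarsh (14.14.1)) give the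
integrand `≪ N^{-ε/2}(1+|τ|)^{-1-β(τ)}`, "où la dernière intégrale est convergente"; and

> **Proposition 3 (HR)** = Prop. 13 + Prop. 14: `I_{N,ε} ≪ N^{-ε/2}`.

This file proves, unconditionally in the two deep inputs, which enter as HYPOTHESES (they are the
statements of Prop. 10 and of (14.14.1) in the form used, both still to be proved in the tree —
Soundararajan's method for `M(x)` and the twisted sums `M_N(iτ)`, resp. Littlewood–Titchmarsh's
bound for `ζ(½+it)` under RH):

* `BalazardDeRoton.betaExp` — `β(τ)`, and `exists_lintegral_weight_le` — **the last integral
  converges**: `∫(1+|τ|)^{-1-β(τ)}dτ < ∞` (comparison with `C/((16+|τ|)log²(16+|τ|))`, an exact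
  derivative);
* `BalazardDeRoton.lintegral_iIntegrand_small_le` — **Prop. 14** from the two pointwise bounds;
* `BalazardDeRoton.iBound_of_pointwise` — **Prop. 3** in the exact shape of hypothesis `hI` of
  `Literature.NumberTheory.LFunctions.BalazardDeRoton2010_thm1_of_props`, from Prop. 10 and
  (14.14.1) as hypotheses and the PROVED Prop. 13 (`exists_lintegral_iIntegrand_tail_le`).

## References

* [BalazardDeRoton2010] M. Balazard, A. de Roton, Int. J. Number Theory 6 (2010) 883–903, Props. 3,
  10, 13, 14 (arXiv:0812.1689 pp. 3, 7, 10–11).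
* [Titchmarsh1986] E. C. Titchmarsh, *The Theory of the Riemann Zeta-Function*, 2nd ed., (14.14.1).
-/

noncomputable section

open Complex Filter Topology Set MeasureTheory Real

namespace Literature.NumberTheory.LFunctions

namespace BalazardDeRoton

open BaezDuarteOnlyIf (moebiusSum)

/-! ## The exponent `β(τ)` and the convergence of `∫(1+|τ|)^{-1-β(τ)}dτ` -/

/-- Balazard–de Roton's `β(τ) = log log log(16+|τ|) / (2 log log(16+|τ|))` (Prop. 10).
[cite: BalazardDeRoton2010, Prop. 10] -/
def betaExp (τ : ℝ) : ℝ :=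
  Real.log (Real.log (Real.log (16 + |τ|))) / (2 * Real.log (Real.log (16 + |τ|)))

/-- `log 16 > e` (`e < 2.72`, `log 16 = 4 log 2 > 4 · 0.69`). [folklore] -/
lemma exp_one_lt_log_sixteen : Real.exp 1 < Real.log 16 := by
  have h2 : (0.6931471803 : ℝ) < Real.log 2 := Real.log_two_gt_d9
  have h16 : Real.log 16 = 4 * Real.log 2 := by
    rw [show (16 : ℝ) = 2 ^ 4 by norm_num, Real.log_pow]; norm_num
  have he := Real.exp_one_lt_d9
  rw [h16]; linarith

/-- For `u = log(16+|τ|)`: `e < u`, `1 < log u`, `0 < log log u`. [folklore] -/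
lemma log_sixteen_add_bounds (τ : ℝ) :
    Real.exp 1 < Real.log (16 + |τ|) ∧ 1 < Real.log (Real.log (16 + |τ|)) ∧
      0 < Real.log (Real.log (Real.log (16 + |τ|))) := by
  have h1 : Real.exp 1 < Real.log (16 + |τ|) :=
    exp_one_lt_log_sixteen.trans_le (Real.log_le_log (by norm_num) (by linarith [abs_nonneg τ]))
  have h2 : 1 < Real.log (Real.log (16 + |τ|)) := by
    rw [← Real.log_exp 1]
    exact Real.log_lt_log (Real.exp_pos 1) h1
  exact ⟨h1, h2, Real.log_pos h2⟩

/-- `0 ≤ β(τ) ≤ 1/2`. [folklore] -/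
lemma betaExp_nonneg_le (τ : ℝ) : 0 ≤ betaExp τ ∧ betaExp τ ≤ 1 / 2 := by
  obtain ⟨-, h2, h3⟩ := log_sixteen_add_bounds τ
  unfold betaExp
  refine ⟨by positivity, ?_⟩
  rw [div_le_iff₀ (by positivity)]
  have := Real.log_le_sub_one_of_pos (by linarith : 0 < Real.log (Real.log (16 + |τ|)))
  linarith

/-- The key comparison: there is `U` with `(1+|τ|)^{β(τ)} ≥ (log(16+|τ|))² / U²` for all `τ`
(for `log(16+|τ|) ≥ U`: `(1+|τ|)^{β} ≥ exp(u log log u/(4 log u)) ≥ u²`, using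
`log(1+|τ|) ≥ u/2` and `u ≥ 8 log² u`; for smaller `u` the left side is `≥ 1`). [folklore] -/
lemma exists_rpow_betaExp_ge : ∃ U : ℝ, 1 ≤ U ∧ ∀ τ : ℝ,
    (Real.log (16 + |τ|)) ^ 2 / U ^ 2 ≤ (1 + |τ|) ^ betaExp τ := by
  refine ⟨373248, by norm_num, fun τ ↦ ?_⟩
  set u : ℝ := Real.log (16 + |τ|) with hu
  obtain ⟨hue, hlu, hllu⟩ := log_sixteen_add_bounds τ
  rw [← hu] at hue hlu hllu
  have hu0 : 0 < u := (Real.exp_pos 1).trans hue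
  have hβ := (betaExp_nonneg_le τ).1
  have hbase : 1 ≤ 1 + |τ| := by linarith [abs_nonneg τ]
  rcases le_or_gt u 373248 with hsmall | hbig
  · -- `u ≤ U`: left side ≤ 1 ≤ right side
    calc u ^ 2 / 373248 ^ 2 ≤ 1 := by
          rw [div_le_one (by positivity)]
          exact pow_le_pow_left₀ hu0.le hsmall 2
      _ ≤ (1 + |τ|) ^ betaExp τ := Real.one_le_rpow hbase hβ
  · -- `u ≥ U`
    have hτ16 : 16 ≤ |τ| := by
      by_contra h
      push Not at h
      have : u ≤ Real.log 32 := by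
        rw [hu]; exact Real.log_le_log (by positivity) (by linarith)
      have h32 : Real.log 32 ≤ 32 := (Real.log_le_sub_one_of_pos (by norm_num)).trans (by norm_num)
      linarith
    -- `log(1+|τ|) ≥ u/2`
    have hlog : u / 2 ≤ Real.log (1 + |τ|) := by
      have h1 : (16 + |τ|) ≤ (1 + |τ|) ^ 2 := by nlinarith
      have h2 : u ≤ Real.log ((1 + |τ|) ^ 2) := Real.log_le_log (by positivity) h1
      rw [Real.log_pow] at h2
      push_cast at h2
      linarith
    -- `u ≥ 8 (log u)²` via `log u ≤ 3 u^{1/3}`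
    have hlogu : Real.log u ≤ 3 * u ^ (1 / 3 : ℝ) := by
      have := Real.log_le_rpow_div hu0.le (by norm_num : (0 : ℝ) < 1 / 3)
      linarith
    have hu13 : 72 ≤ u ^ (1 / 3 : ℝ) := by
      have : (373248 : ℝ) = 72 ^ (3 : ℝ) := by norm_num
      calc (72 : ℝ) = (72 ^ (3 : ℝ)) ^ (1 / 3 : ℝ) := by rw [← Real.rpow_mul (by norm_num)]; norm_num
        _ ≤ u ^ (1 / 3 : ℝ) := Real.rpow_le_rpow (by positivity) (by rw [← this]; exact hbig.le)
            (by norm_num)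
    have hkey : 8 * (Real.log u) ^ 2 ≤ u := by
      have h1 : (Real.log u) ^ 2 ≤ 9 * (u ^ (1 / 3 : ℝ)) ^ 2 := by
        nlinarith [Real.log_nonneg (by linarith : 1 ≤ u)]
      have h2 : (u ^ (1 / 3 : ℝ)) ^ 2 * u ^ (1 / 3 : ℝ) = u := by
        rw [← pow_succ, ← Real.rpow_natCast, ← Real.rpow_mul hu0.le]; norm_num
      have h3 : 0 ≤ (u ^ (1 / 3 : ℝ)) ^ 2 := sq_nonneg _
      nlinarith
    -- assemble: `(1+|τ|)^β = exp(β log(1+|τ|)) ≥ exp(β u/2) ≥ exp(2 log u) = u²`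
    have hll1 : 1 ≤ Real.log (Real.log u) := by
      -- `log u > e` since `u ≥ 373248 > e^e`? we only need `log log u ≥ 1`, i.e. `log u ≥ e`
      have : Real.exp 1 ≤ Real.log u := by
        have h15 : Real.exp 1 ≤ 3 := by have := Real.exp_one_lt_d9; linarith
        refine h15.trans ?_
        rw [Real.le_log_iff_exp_le hu0]
        have : Real.exp 3 ≤ 373248 := by
          have := Real.exp_one_lt_d9
          calc Real.exp 3 = Real.exp 1 ^ 3 := by rw [← Real.exp_nat_mul]; norm_num
            _ ≤ 3 ^ 3 := by gcongr
            _ ≤ 373248 := by norm_num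
        linarith
      calc (1 : ℝ) = Real.log (Real.exp 1) := (Real.log_exp 1).symm
        _ ≤ Real.log (Real.log u) := Real.log_le_log (Real.exp_pos 1) this
    have hexp : 2 * Real.log u ≤ betaExp τ * Real.log (1 + |τ|) := by
      have hb : betaExp τ = Real.log (Real.log u) / (2 * Real.log u) := by rw [betaExp, ← hu]
      rw [hb]
      have hlu0 : 0 < Real.log u := by linarith
      calc 2 * Real.log u ≤ 1 / (2 * Real.log u) * (u / 2) := by
            rw [div_mul_div_comm, one_mul, le_div_iff₀ (by positivity)]
            nlinarith
        _ ≤ Real.log (Real.log u) / (2 * Real.log u) * Real.log (1 + |τ|) := by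
            gcongr
    calc u ^ 2 / 373248 ^ 2 ≤ u ^ 2 := div_le_self (sq_nonneg _) (by norm_num)
      _ = Real.exp (2 * Real.log u) := by
          rw [show (2 : ℝ) * Real.log u = Real.log u * 2 by ring, Real.exp_mul, Real.exp_log hu0,
            ← Real.rpow_natCast]
          norm_num
      _ ≤ Real.exp (betaExp τ * Real.log (1 + |τ|)) := Real.exp_le_exp.mpr hexp
      _ = (1 + |τ|) ^ betaExp τ := by
          rw [Real.rpow_def_of_pos (by linarith [abs_nonneg τ]), mul_comm]

/-- **Domination of the weight**: with `U` as above,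
`(1+|τ|)^{-(1+β(τ))} ≤ 16U²/((16+|τ|) log²(16+|τ|))` for all `τ`. [folklore] -/
lemma weight_le {U : ℝ} (hU : 1 ≤ U)
    (hUβ : ∀ τ : ℝ, (Real.log (16 + |τ|)) ^ 2 / U ^ 2 ≤ (1 + |τ|) ^ betaExp τ) (τ : ℝ) :
    (1 + |τ|) ^ (-(1 + betaExp τ)) ≤ 16 * U ^ 2 / ((16 + |τ|) * (Real.log (16 + |τ|)) ^ 2) := by
  obtain ⟨hue, -, -⟩ := log_sixteen_add_bounds τ
  set u : ℝ := Real.log (16 + |τ|) with hu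
  have hu0 : 0 < u := (Real.exp_pos 1).trans hue
  have hτ0 : 0 < 1 + |τ| := by positivity
  have hb := hUβ τ
  rw [← hu] at hb
  rw [Real.rpow_neg hτ0.le, Real.rpow_add hτ0, Real.rpow_one, inv_eq_one_div,
    div_le_div_iff₀ (by positivity) (by positivity), one_mul]
  have h1 : u ^ 2 ≤ U ^ 2 * (1 + |τ|) ^ betaExp τ := by
    rw [div_le_iff₀ (by positivity)] at hb; linarith
  have h2 : (16 + |τ|) ≤ 16 * (1 + |τ|) := by linarith [abs_nonneg τ]
  have h3 : 0 ≤ (1 + |τ|) ^ betaExp τ := Real.rpow_nonneg hτ0.le _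
  calc (16 + |τ|) * u ^ 2 ≤ (16 * (1 + |τ|)) * (U ^ 2 * (1 + |τ|) ^ betaExp τ) :=
        mul_le_mul h2 h1 (sq_nonneg _) (by positivity)
    _ = 16 * U ^ 2 * ((1 + |τ|) * (1 + |τ|) ^ betaExp τ) := by ring

/-- The majorant `1/((16+|τ|) log²(16+|τ|))` is integrable on `ℝ` (it is the derivative of
`−1/log(16+τ)` on `τ ≥ 0`, and even). [folklore] -/
lemma integrable_majorant :
    Integrable fun τ : ℝ ↦ 1 / ((16 + |τ|) * (Real.log (16 + |τ|)) ^ 2) := by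
  set f : ℝ → ℝ := fun τ ↦ 1 / ((16 + |τ|) * (Real.log (16 + |τ|)) ^ 2) with hf
  -- on `(0, ∞)`: fundamental theorem of calculus for the improper integral
  have hIoi : IntegrableOn f (Ioi 0) := by
    have hg : ∀ x ∈ Ioi (0 : ℝ), HasDerivAt (fun x : ℝ ↦ -(Real.log (16 + x))⁻¹)
        (1 / ((16 + x) * (Real.log (16 + x)) ^ 2)) x := by
      intro x hx
      have hx : (0 : ℝ) < x := hx
      have h16 : (0 : ℝ) < 16 + x := by linarith
      have hlog : Real.log (16 + x) ≠ 0 := by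
        have : 1 < 16 + x := by linarith
        exact (Real.log_pos this).ne'
      have h1 : HasDerivAt (fun x : ℝ ↦ Real.log (16 + x)) (1 / (16 + x)) x := by
        have := ((hasDerivAt_id x).const_add 16).log h16.ne'
        simpa using this
      have h2 := (h1.inv hlog).neg
      refine h2.congr_deriv ?_
      field_simp
    have hderiv : ∀ x ∈ Ioi (0 : ℝ), HasDerivAt (fun x : ℝ ↦ -(Real.log (16 + x))⁻¹) (f x) x := by
      intro x hx
      have hx' : (0 : ℝ) < x := hx
      have : f x = 1 / ((16 + x) * (Real.log (16 + x)) ^ 2) := by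
        simp only [hf, abs_of_pos hx']
      rw [this]; exact hg x hx
    refine integrableOn_Ioi_deriv_of_nonneg (g := fun x : ℝ ↦ -(Real.log (16 + x))⁻¹) (l := 0)
      ?_ hderiv (fun x _ ↦ by simp only [hf]; positivity) ?_
    · have h1 : ContinuousAt (fun x : ℝ ↦ Real.log (16 + x)) 0 :=
        (Real.continuousAt_log (by norm_num)).comp (continuousAt_const.add continuousAt_id)
      have h2 : Real.log (16 + (0 : ℝ)) ≠ 0 := by
        rw [add_zero]; exact (Real.log_pos (by norm_num)).ne'
      exact ((h1.inv₀ h2).neg).continuousWithinAt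
    · have h1 : Tendsto (fun x : ℝ ↦ Real.log (16 + x)) atTop atTop :=
        Real.tendsto_log_atTop.comp (tendsto_atTop_add_const_left atTop 16 tendsto_id)
      have h2 := (tendsto_inv_atTop_zero.comp h1).neg
      rw [neg_zero] at h2
      exact h2
  -- on `(−∞, 0)` by evenness, and everywhere
  have hIio : IntegrableOn f (Iio 0) := by
    have h := hIoi.comp_neg
    have hneg : -(Ioi (0 : ℝ)) = Iio 0 := by ext x; simp
    rw [hneg] at h
    refine h.congr_fun (fun x _ ↦ ?_) measurableSet_Iio
    simp only [hf, abs_neg]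
  have hIci : IntegrableOn f (Ici 0) := (integrableOn_Ici_iff_integrableOn_Ioi).mpr hIoi
  have huniv : IntegrableOn f (Iio 0 ∪ Ici 0) := integrableOn_union.mpr ⟨hIio, hIci⟩
  rwa [Iio_union_Ici, integrableOn_univ] at huniv

/-- **"la dernière intégrale est convergente"**: `∫_ℝ (1+|τ|)^{-1-β(τ)} dτ < ∞`, as a bound for
the lower Lebesgue integral. [cite: BalazardDeRoton2010, Prop. 14 (proof, last line)] -/
theorem exists_lintegral_weight_le : ∃ M : ℝ, 0 ≤ M ∧
    ∫⁻ τ : ℝ, ENNReal.ofReal ((1 + |τ|) ^ (-(1 + betaExp τ))) ≤ ENNReal.ofReal M := by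
  obtain ⟨U, hU, hUβ⟩ := exists_rpow_betaExp_ge
  set m : ℝ → ℝ := fun τ ↦ 16 * U ^ 2 * (1 / ((16 + |τ|) * (Real.log (16 + |τ|)) ^ 2)) with hm
  have hmi : Integrable m := integrable_majorant.const_mul _
  have hm0 : ∀ τ, 0 ≤ m τ := fun τ ↦ by positivity
  refine ⟨∫ τ, m τ, integral_nonneg hm0, ?_⟩
  rw [ofReal_integral_eq_lintegral_ofReal hmi (ae_of_all _ hm0)]
  refine lintegral_mono fun τ ↦ ENNReal.ofReal_le_ofReal ?_
  have := weight_le hU hUβ τ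
  simp only [hm]
  rw [← mul_one_div]  at this
  exact this

/-! ## Proposition 14 -/

/-- `(1+|τ|)²/8 ≤ |½+iτ|²`. [folklore] -/
lemma one_add_abs_sq_div_le (τ : ℝ) : (1 + |τ|) ^ 2 / 8 ≤ ‖(1 / 2 + τ * I : ℂ)‖ ^ 2 := by
  rw [Complex.sq_norm, Complex.normSq_apply]
  simp
  have := sq_abs τ
  nlinarith [abs_nonneg τ]

/-- **Pointwise, Prop. 14**: if `|ζ(s+ε)^{-1} − M_N(s+ε)| ≤ K N^{-ε/4}(1+|τ|)^{1/2−β(τ)}` and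
`|ζ(s)|² ≤ K'(1+|τ|)^{β(τ)}`, then `iIntegrand N ε τ ≤ 8K'K² N^{-ε/2}(1+|τ|)^{-1-β(τ)}`.
[cite: BalazardDeRoton2010, Prop. 14 (proof)] -/
lemma iIntegrand_le_weight {K K' : ℝ} (hK' : 0 ≤ K') {N : ℕ} (hN : 1 ≤ N) {ε : ℝ}
    {τ : ℝ}
    (hP : ‖(riemannZeta (1 / 2 + ε + τ * I))⁻¹ - moebiusSum N (1 / 2 + ε + τ * I)‖ ≤
      K * (N : ℝ) ^ (-ε / 4) * (1 + |τ|) ^ (1 / 2 - betaExp τ))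
    (hZ : ‖riemannZeta (1 / 2 + τ * I)‖ ^ 2 ≤ K' * (1 + |τ|) ^ betaExp τ) :
    iIntegrand N ε τ ≤ 8 * K' * K ^ 2 * (N : ℝ) ^ (-ε / 2) * (1 + |τ|) ^ (-(1 + betaExp τ)) := by
  have hN0 : (0 : ℝ) < N := by exact_mod_cast hN
  have hτ0 : 0 < 1 + |τ| := by positivity
  set T : ℝ := 1 + |τ| with hT
  set b : ℝ := betaExp τ with hb
  have hden := one_add_abs_sq_div_le τ
  have hs0 : 0 < ‖(1 / 2 + τ * I : ℂ)‖ ^ 2 := lt_of_lt_of_le (by positivity) hden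
  -- the square of the approximation error
  have hR : ‖moebiusSum N (1 / 2 + ε + τ * I) - (riemannZeta (1 / 2 + ε + τ * I))⁻¹‖ ^ 2 ≤
      K ^ 2 * (N : ℝ) ^ (-ε / 2) * T ^ (1 - 2 * b) := by
    rw [norm_sub_rev]
    calc _ ≤ (K * (N : ℝ) ^ (-ε / 4) * T ^ (1 / 2 - b)) ^ 2 := pow_le_pow_left₀ (norm_nonneg _) hP 2
      _ = K ^ 2 * ((N : ℝ) ^ (-ε / 4)) ^ 2 * (T ^ (1 / 2 - b)) ^ 2 := by ring
      _ = K ^ 2 * (N : ℝ) ^ (-ε / 2) * T ^ (1 - 2 * b) := by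
          rw [← Real.rpow_natCast ((N : ℝ) ^ (-ε / 4)) 2, ← Real.rpow_mul hN0.le,
            ← Real.rpow_natCast (T ^ (1 / 2 - b)) 2, ← Real.rpow_mul hτ0.le]
          congr 2 <;> push_cast <;> ring
  unfold iIntegrand
  rw [div_le_iff₀ hs0]
  have hexp : T ^ b * T ^ (1 - 2 * b) = T ^ (-(1 + b)) * T ^ 2 := by
    rw [← Real.rpow_add hτ0, show (T ^ 2 : ℝ) = T ^ (2 : ℝ) by norm_cast, ← Real.rpow_add hτ0]
    congr 1; ring
  calc ‖riemannZeta (1 / 2 + τ * I)‖ ^ 2 *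
        ‖moebiusSum N (1 / 2 + ε + τ * I) - (riemannZeta (1 / 2 + ε + τ * I))⁻¹‖ ^ 2
      ≤ (K' * T ^ b) * (K ^ 2 * (N : ℝ) ^ (-ε / 2) * T ^ (1 - 2 * b)) :=
        mul_le_mul hZ hR (sq_nonneg _) (by positivity)
    _ = K' * K ^ 2 * (N : ℝ) ^ (-ε / 2) * (T ^ b * T ^ (1 - 2 * b)) := by ring
    _ = K' * K ^ 2 * (N : ℝ) ^ (-ε / 2) * T ^ (-(1 + b)) * (8 * (T ^ 2 / 8)) := by
        rw [hexp]; ring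
    _ ≤ K' * K ^ 2 * (N : ℝ) ^ (-ε / 2) * T ^ (-(1 + b)) * (8 * ‖(1 / 2 + τ * I : ℂ)‖ ^ 2) := by
        gcongr
    _ = 8 * K' * K ^ 2 * (N : ℝ) ^ (-ε / 2) * T ^ (-(1 + b)) * ‖(1 / 2 + τ * I : ℂ)‖ ^ 2 := by
        ring

/-- **Balazard–de Roton 2010, Proposition 14 (HR), from Prop. 10 and (14.14.1) as hypotheses**:
`∫_{|τ|<T} iIntegrand N ε ≤ 8K'K² M N^{-ε/2}`, `M = ∫(1+|τ|)^{-1-β}`.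
[cite: BalazardDeRoton2010, Prop. 14] -/
theorem lintegral_iIntegrand_small_le {K K' M : ℝ} (hK' : 0 ≤ K')
    (hM : ∫⁻ τ : ℝ, ENNReal.ofReal ((1 + |τ|) ^ (-(1 + betaExp τ))) ≤ ENNReal.ofReal M)
    {N : ℕ} (hN : 1 ≤ N) {ε T : ℝ}
    (hP10 : ∀ τ : ℝ, |τ| ≤ T →
      ‖(riemannZeta (1 / 2 + ε + τ * I))⁻¹ - moebiusSum N (1 / 2 + ε + τ * I)‖ ≤
        K * (N : ℝ) ^ (-ε / 4) * (1 + |τ|) ^ (1 / 2 - betaExp τ))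
    (hZ : ∀ τ : ℝ, ‖riemannZeta (1 / 2 + τ * I)‖ ^ 2 ≤ K' * (1 + |τ|) ^ betaExp τ) :
    ∫⁻ τ in {τ : ℝ | |τ| < T}, ENNReal.ofReal (iIntegrand N ε τ) ≤
      ENNReal.ofReal (8 * K' * K ^ 2 * (N : ℝ) ^ (-ε / 2) * M) := by
  set c : ℝ := 8 * K' * K ^ 2 * (N : ℝ) ^ (-ε / 2) with hc
  have hc0 : 0 ≤ c := by positivity
  calc ∫⁻ τ in {τ : ℝ | |τ| < T}, ENNReal.ofReal (iIntegrand N ε τ)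
      ≤ ∫⁻ τ in {τ : ℝ | |τ| < T}, ENNReal.ofReal (c * (1 + |τ|) ^ (-(1 + betaExp τ))) := by
        refine setLIntegral_mono' (measurableSet_lt measurable_id.abs measurable_const)
          fun τ hτ ↦ ENNReal.ofReal_le_ofReal ?_
        exact iIntegrand_le_weight hK' hN (hP10 τ (le_of_lt hτ)) (hZ τ)
    _ ≤ ∫⁻ τ, ENNReal.ofReal (c * (1 + |τ|) ^ (-(1 + betaExp τ))) := setLIntegral_le_lintegral _ _
    _ = ENNReal.ofReal c * ∫⁻ τ, ENNReal.ofReal ((1 + |τ|) ^ (-(1 + betaExp τ))) := by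
        rw [← lintegral_const_mul' _ _ ENNReal.ofReal_ne_top]
        congr 1; funext τ
        exact ENNReal.ofReal_mul hc0
    _ ≤ ENNReal.ofReal c * ENNReal.ofReal M := mul_le_mul_right hM _
    _ = ENNReal.ofReal (c * M) := (ENNReal.ofReal_mul hc0).symm

/-! ## Proposition 3: `hI` from Prop. 10, (14.14.1) and Prop. 13 -/

/-- **Balazard–de Roton 2010, Proposition 3 (HR) from its inputs**: given the pointwise
approximation of Prop. 10 (for every `0 < δ ≤ 1/2`: `A, K, N₀` with
`|ζ(s+ε)^{-1} − M_N(s+ε)| ≤ K N^{-ε/4}(1+|τ|)^{1/2−β(τ)}` for `N ≥ N₀`,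
`A(log log N)^{5/2+δ}(log N)^{-1/2} ≤ ε ≤ 1/4`, `|τ| ≤ N^{3/4}`) and the critical-line bound
`|ζ(½+iτ)|² ≤ K'(1+|τ|)^{β(τ)}` (from Titchmarsh (14.14.1)), the hypothesis `hI` of
`BalazardDeRoton2010_thm1_of_props` holds: `∫ iIntegrand N ε ≤ C₂ N^{-ε/2}`. The large ordinates
are Prop. 13 (proved, `exists_lintegral_iIntegrand_tail_le`), the small ones Prop. 14.
[cite: BalazardDeRoton2010, Prop. 3] -/
theorem iBound_of_pointwise (hRH : RiemannHypothesis)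
    (hP10 : ∀ δ : ℝ, 0 < δ → δ ≤ 1 / 2 → ∃ (A K : ℝ) (N₀ : ℕ), 0 < A ∧ 0 < K ∧
      ∀ N : ℕ, N₀ ≤ N → ∀ ε : ℝ,
        A * Real.log (Real.log (N : ℝ)) ^ (5 / 2 + δ) * Real.log (N : ℝ) ^ (-(1 / 2 : ℝ)) ≤ ε →
        ε ≤ 1 / 4 → ∀ τ : ℝ, |τ| ≤ (N : ℝ) ^ (3 / 4 : ℝ) →
          ‖(riemannZeta (1 / 2 + ε + τ * I))⁻¹ - moebiusSum N (1 / 2 + ε + τ * I)‖ ≤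
            K * (N : ℝ) ^ (-ε / 4) * (1 + |τ|) ^ (1 / 2 - betaExp τ))
    (hZ : ∃ K' : ℝ, 0 < K' ∧ ∀ τ : ℝ,
      ‖riemannZeta (1 / 2 + τ * I)‖ ^ 2 ≤ K' * (1 + |τ|) ^ betaExp τ) :
    ∀ δ : ℝ, 0 < δ → δ ≤ 1 / 2 → ∃ (A C₂ ε₂ : ℝ) (N₀ : ℕ), 0 < A ∧ 0 < ε₂ ∧
      ∀ N : ℕ, N₀ ≤ N → ∀ ε : ℝ,
        A * Real.log (Real.log (N : ℝ)) ^ (5 / 2 + δ) * Real.log (N : ℝ) ^ (-(1 / 2 : ℝ)) ≤ ε →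
          ε ≤ ε₂ →
          ∫⁻ τ, ENNReal.ofReal (iIntegrand N ε τ) ≤ ENNReal.ofReal (C₂ * (N : ℝ) ^ (-ε / 2)) := by
  intro δ hδ hδ2
  obtain ⟨A, K, N₀, hA, hK, hP⟩ := hP10 δ hδ hδ2
  obtain ⟨K', hK', hZ'⟩ := hZ
  obtain ⟨M, hM0, hM⟩ := exists_lintegral_weight_le
  obtain ⟨C₁₃, hC₁₃, h13⟩ := exists_lintegral_iIntegrand_tail_le hRH
  refine ⟨A, 8 * K' * K ^ 2 * M + C₁₃, 1 / 4, max N₀ 3, hA, by norm_num, fun N hN ε hε1 hε2 ↦ ?_⟩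
  have hN₀ : N₀ ≤ N := le_of_max_le_left hN
  have hN3 : 3 ≤ N := le_of_max_le_right hN
  have hN1 : 1 ≤ N := by omega
  have hN1' : (1 : ℝ) ≤ N := by exact_mod_cast hN1
  -- `ε > 0` (the threshold is positive for `N ≥ 3`)
  obtain ⟨hL, hLL⟩ := log_log_three_le hN3
  have hLL0 : 0 < Real.log (Real.log (N : ℝ)) := log_log_three_pos.trans_le hLL
  have hε0 : 0 < ε := lt_of_lt_of_le
    (mul_pos (mul_pos hA (Real.rpow_pos_of_pos hLL0 _)) (Real.rpow_pos_of_pos hL _)) hε1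
  set T : ℝ := (N : ℝ) ^ (3 / 4 : ℝ) with hT
  -- small and large ordinates
  have hsmall := lintegral_iIntegrand_small_le hK'.le hM hN1 (T := T)
    (fun τ hτ ↦ hP N hN₀ ε hε1 hε2 τ hτ) hZ'
  have hlarge := h13 N hN1 ε hε0 hε2
  have hunion : (univ : Set ℝ) = {τ : ℝ | |τ| < T} ∪ {τ : ℝ | T ≤ |τ|} := by
    ext τ; simp [lt_or_ge]
  have hpow : (N : ℝ) ^ (-(3 / 8 : ℝ)) ≤ (N : ℝ) ^ (-ε / 2) :=
    Real.rpow_le_rpow_of_exponent_le hN1' (by linarith)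
  calc ∫⁻ τ, ENNReal.ofReal (iIntegrand N ε τ)
      = ∫⁻ τ in {τ : ℝ | |τ| < T} ∪ {τ : ℝ | T ≤ |τ|}, ENNReal.ofReal (iIntegrand N ε τ) := by
        rw [← hunion, Measure.restrict_univ]
    _ ≤ (∫⁻ τ in {τ : ℝ | |τ| < T}, ENNReal.ofReal (iIntegrand N ε τ)) +
          ∫⁻ τ in {τ : ℝ | T ≤ |τ|}, ENNReal.ofReal (iIntegrand N ε τ) := lintegral_union_le _ _ _
    _ ≤ ENNReal.ofReal (8 * K' * K ^ 2 * (N : ℝ) ^ (-ε / 2) * M) +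
          ENNReal.ofReal (C₁₃ * (N : ℝ) ^ (-(3 / 8 : ℝ))) := add_le_add hsmall hlarge
    _ = ENNReal.ofReal (8 * K' * K ^ 2 * (N : ℝ) ^ (-ε / 2) * M + C₁₃ * (N : ℝ) ^ (-(3 / 8 : ℝ))) :=
        (ENNReal.ofReal_add (by positivity) (by positivity)).symm
    _ ≤ ENNReal.ofReal ((8 * K' * K ^ 2 * M + C₁₃) * (N : ℝ) ^ (-ε / 2)) := by
        refine ENNReal.ofReal_le_ofReal ?_
        have : C₁₃ * (N : ℝ) ^ (-(3 / 8 : ℝ)) ≤ C₁₃ * (N : ℝ) ^ (-ε / 2) :=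
          mul_le_mul_of_nonneg_left hpow hC₁₃.le
        nlinarith [Real.rpow_nonneg (Nat.cast_nonneg N) (-ε / 2), mul_nonneg (mul_nonneg
          (mul_nonneg (by norm_num : (0:ℝ) ≤ 8) hK'.le) (sq_nonneg K)) hM0]

end BalazardDeRoton

end Literature.NumberTheory.LFunctions

end
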